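import Literature.NumberTheory.EllipticCurves.KubertTateNormalForm
import HarnessLib

/-!
# The raw plane model of the modular curve `X₁(13)` in Tate normal form

Topic `NumberTheory/EllipticCurves`; continues `Literature.NumberTheory.EllipticCurves.KubertTateNormalForm`
(the Tate normal form `E(b, c) : y² + (1 - c)xy - by = x³ - bx²` with marked point `P = (0, 0)`,
and its first multiples `2P = (b, bc)`, `3P = (c, b - c)`, Knapp §V.5 (5.30)). Everything here is
PROVED; nothing is a named fact.

Following Reichert (1986) and Sutherland (2012, §2 "Computing the raw form of `X₁(N)`"): for
`N > 5` put `r = b/c`, `s = c²/(b - c)`, i.e. `b = rs(r - 1)`, `c = s(r - 1)`; then the multiples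
of `P` have small coordinates, `NP = 𝒪 ⟺ x(mP) = x(nP)` for `m + n = N`, `m ≠ n`, and clearing
denominators in `x(7P) = x(6P)` and discarding the factors supported on the degenerate locus gives
a polynomial `F(r, s)` with "`F(r, s) = 0` is a defining equation for `X₁(N)`. By construction, any
solution to `F(r, s) = 0` will produce a curve `E(b, c)`, with `c = s(r - 1)` and `b = rc`, on which
`P` is a point of order `N`, provided that `Δ(b, c) ≠ 0`. Conversely, any curve `E(b, c)` on which
`P` has order `N > 5` yields a solution `r = b/c`, `s = c²/(b - c)` to `F(r, s) = 0`. These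
statements hold for any field `K`" (Sutherland 2012, §2). This file carries this out for `N = 13`
inside Lean, over an arbitrary field `F`:

* `kubertTate_some_add_some_zero` — the chord step `(x₁, y₁) + (0, 0)` on `E(b, c)`, `x₁ ≠ 0`:
  slope `λ = y₁/x₁`, `x₃ = λ² + (1 - c)λ + b - x₁`, `y₃ = -(λ + 1 - c)x₃ + b`;
* `kubertTate_four_nsmul_zero`, `…_five_…`, `…_six_…`, `…_seven_…` — on `E(rs(r-1), s(r-1))`:
  `4P = (r(r-1), r²(r-1)(s-1))`, `5P = (rs(s-1), rs²(r-s))`,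
  `6P = (s(r-1)(r-s)/(s-1)², s²(r-1)²(rs-2r+1)/(s-1)³)` and
  `x(7P) = x(6P) - s(r-1)·F₁₃(r,s)/((s-1)²(r-s)²)`, where
* `kubertTateRaw₁₃ r s = F₁₃(r, s) := (r - s)³ - r(s - 1)³(rs - 2r + 1)` is (minus) Sutherland's
  raw form of `X₁(13)` (expanded: `r³ - r²s⁴ + 5r²s³ - 9r²s² + 4r²s - 2r² - rs³ + 6rs² - 3rs + r - s³`,
  bidegree `(3, 4)`, genus `2`);
* `kubertTate_thirteen_nsmul_zero_iff` — for `r ∉ {0, 1}`, `s ∉ {0, 1}`, `r ≠ s`: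
  `13P = 𝒪 ⟺ F₁₃(r, s) = 0`;
* `kubertTateX₁₃ b c` — the same equation pulled back to the `(b, c)`-plane,
  `X₁₃(b, c) := -c³(b - c)⁴·F_S(b/c, c²/(b - c))` (`F_S = -F₁₃` Sutherland's sign), an explicit
  polynomial of total degree `11` with `20` terms, `X₁₃(rs(r-1), s(r-1)) = s⁷(r-1)¹¹ F₁₃(r, s)`
  (`kubertTateX₁₃_eq_mul_raw`), `X₁₃(b, 0) = b⁷`, `X₁₃(b, b) = -b¹¹`;
* **`kubertTate_addOrderOf_zero_eq_thirteen_iff`** — for every field `F` and all `b c : F` with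
  `(0, 0)` nonsingular on `E(b, c)` (i.e. `b ≠ 0`; no condition on `Δ`):
  `addOrderOf (0, 0) = 13 ⟺ X₁₃(b, c) = 0`; and its `(r, s)` form
  `kubertTate_addOrderOf_zero_eq_thirteen_iff_raw` : on `E(rs(r-1), s(r-1))`,
  `addOrderOf (0, 0) = 13 ⟺ F₁₃(r, s) = 0`.

All non-degeneracy needed along the way (`c ≠ 0`, `b ≠ c`, `s ≠ 1`, `r ≠ s`, i.e. `4P, 5P, 6P, 7P ≠ 𝒪`
and `≠ ±P`) is derived inside the proofs from `addOrderOf P = 13`, resp. from `X₁₃(b, c) = 0`, via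
Mathlib's `WeierstrassCurve.Affine.Point.X_eq_iff` (equal `x`-coordinates force `Q = ±Q'`). The
polynomial identities were derived by hand and are certified here by `ring`/`field_simp`; they agree
with Sutherland's optimized model `X₁(13) : y² + (x³ + x² + 1)y - x² - x = 0`, `r = 1 - xy`,
`s = 1 - xy/(y + 1)` (Sutherland 2012, §1), which is not formalized here.

Use: `Literature.NumberTheory.EllipticCurves.MazurTorsionProofs` turns Mazur–Tate's theorem
"no rational `13`-torsion over `ℚ`" (`= Y₁(13)(ℚ) = ∅`) into the Diophantine statement
`∀ b c : ℚ, Δ(b, c) ≠ 0 → X₁₃(b, c) ≠ 0` about this explicit genus-`2` plane curve.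

## References

* [Sutherland2012] A. V. Sutherland, *Constructing elliptic curves over finite fields with
  prescribed torsion*, Math. Comp. 81 (2012) 1131–1147, §2 (raw form of `X₁(N)`: `r, s`,
  `x_{n+1} = b yₙ/xₙ²`, `NP = 0 ⟺ x_m = x_n`, the defining-equation claim quoted above; table of
  `xₙ`, `n ≤ 10`; Table "raw form of `X₁(N)`", entry `N = 13`), §1 (optimized `X₁(13)`).
* [Knapp1993] A. W. Knapp, *Elliptic Curves*, Princeton Math. Notes 40 (1992), §V.5 pp. 146–147
  (Tate normal form, (5.30)–(5.31)).
* [Kubert1976] D. S. Kubert, *Universal bounds on the torsion of elliptic curves*, Proc. London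
  Math. Soc. (3) 33 (1976) 193–237 (the parametrisations).
* M. A. Reichert, *Explicit determination of nontrivial torsion structures of elliptic curves over
  quadratic number fields*, Math. Comp. 46 (1986) 637–658 (equations of `X₁(N)`, `11 ≤ N ≤ 18`).

## Design choices

* Deliberate dot-notation-style extension of Mathlib's `WeierstrassCurve` namespace, next to the
  tree's `WeierstrassCurve.kubertTate` (file `KubertTateNormalForm`), over a general field with
  `[DecidableEq F]` exactly as Mathlib's affine point API.
* Multiples are stated as `∃ h, k • P = .some xₖ yₖ h` (the nonsingularity witness of an explicit
  point is part of Mathlib's point data; it is produced by the group law, never computed by hand).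
* The `(b, c)`-polynomial `kubertTateX₁₃` is written out in full (20 monomials) so that statements
  over `ℚ` need no side conditions besides `Δ ≠ 0`; its relation to the `(r, s)` form is the proved
  identity `kubertTateX₁₃_eq_mul_raw`, not a definition.
-/

noncomputable section

namespace WeierstrassCurve

/-! ### The two plane equations -/

section Ring

variable {R : Type*} [CommRing R]

/-- **The raw form of `X₁(13)`** in Sutherland's coordinates `(r, s)` (`b = rs(r-1)`, `c = s(r-1)`):
`F₁₃(r, s) := (r - s)³ - r(s - 1)³(rs - 2r + 1)`, i.e. minus Sutherland's
`r(s-1)³(rs-2r+1) - (r-s)³ = -r³ + r²s⁴ - 5r²s³ + 9r²s² - 4r²s + 2r² + rs³ - 6rs² + 3rs - r + s³`,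
the numerator of `x(7P) - x(6P)` on `E(rs(r-1), s(r-1))` stripped of the degenerate factors
`s`, `r - 1`, `(s - 1)²`, `(r - s)²` (`kubertTate_seven_nsmul_zero`). [cite: Sutherland2012, §2 (raw form F(r,s) of X₁(N) from x_m = x_n; Table of raw forms, N = 13)] -/
def kubertTateRaw₁₃ (r s : R) : R :=
  (r - s) ^ 3 - r * (s - 1) ^ 3 * (r * s - 2 * r + 1)

/-- **The raw form of `X₁(13)` in the Tate-normal-form coordinates `(b, c)`**: the polynomial
`X₁₃(b, c) = -c³(b - c)⁴ · F(b/c, c²/(b - c))` (`F` Sutherland's raw form, `r = b/c`,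
`s = c²/(b - c)`), written out:
`b⁷ - 6b⁶c + 15b⁵c² + 4b⁵c³ - 20b⁴c³ - 15b⁴c⁴ - 9b⁴c⁵ + 15b³c⁴ + 21b³c⁵ + 24b³c⁶ + 5b³c⁷ - 6b²c⁵
 - 13b²c⁶ - 21b²c⁷ - 6b²c⁸ - b²c⁹ + bc⁶ + 3bc⁷ + 6bc⁸ + c¹⁰`
(total degree `11`). Its zero locus in `{b ≠ 0}` is exactly the set of `(b, c)` for which `(0,0)`
has order `13` on `E(b, c)` (`kubertTate_addOrderOf_zero_eq_thirteen_iff`). [cite: Sutherland2012, §2 (r = b/c, s = c²/(b−c); defining equation of X₁(N)), N = 13] -/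
def kubertTateX₁₃ (b c : R) : R :=
  b ^ 7 - 6 * b ^ 6 * c + 15 * b ^ 5 * c ^ 2 + 4 * b ^ 5 * c ^ 3 - 20 * b ^ 4 * c ^ 3
    - 15 * b ^ 4 * c ^ 4 - 9 * b ^ 4 * c ^ 5 + 15 * b ^ 3 * c ^ 4 + 21 * b ^ 3 * c ^ 5
    + 24 * b ^ 3 * c ^ 6 + 5 * b ^ 3 * c ^ 7 - 6 * b ^ 2 * c ^ 5 - 13 * b ^ 2 * c ^ 6
    - 21 * b ^ 2 * c ^ 7 - 6 * b ^ 2 * c ^ 8 - b ^ 2 * c ^ 9 + b * c ^ 6 + 3 * b * c ^ 7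
    + 6 * b * c ^ 8 + c ^ 10

/-- `F₁₃(r, 1) = (r - 1)³` (the line `s = 1`, where `6P = 𝒪`, meets the raw curve only at the
degenerate point `r = 1`). [folklore] -/
theorem kubertTateRaw₁₃_self_one (r : R) : kubertTateRaw₁₃ r 1 = (r - 1) ^ 3 := by
  simp only [kubertTateRaw₁₃]
  ring

/-- `F₁₃(s, s) = -s(s - 1)⁵` (the diagonal `r = s`, where `7P = 𝒪`, meets the raw curve only at
degenerate points). [folklore] -/
theorem kubertTateRaw₁₃_self_self (s : R) : kubertTateRaw₁₃ s s = -(s * (s - 1) ^ 5) := by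
  simp only [kubertTateRaw₁₃]
  ring

/-- `X₁₃(b, 0) = b⁷` (the line `c = 0`, where `4P = 𝒪`). [folklore] -/
theorem kubertTateX₁₃_zero_right (b : R) : kubertTateX₁₃ b 0 = b ^ 7 := by
  simp only [kubertTateX₁₃]
  ring

/-- `X₁₃(b, b) = -b¹¹` (the line `b = c`, where `5P = 𝒪`). [folklore] -/
theorem kubertTateX₁₃_self_self (b : R) : kubertTateX₁₃ b b = -b ^ 11 := by
  simp only [kubertTateX₁₃]
  ring

/-- **The two raw forms agree**: `X₁₃(rs(r-1), s(r-1)) = s⁷ (r-1)¹¹ · F₁₃(r, s)` (substitute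
`b = rs(r-1)`, `c = s(r-1)`, so `c³(b-c)⁴ = s⁷(r-1)¹¹`). [cite: Sutherland2012, §2 (b = rs(r−1), c = s(r−1))] -/
theorem kubertTateX₁₃_eq_mul_raw (r s : R) :
    kubertTateX₁₃ (r * s * (r - 1)) (s * (r - 1)) =
      s ^ 7 * (r - 1) ^ 11 * kubertTateRaw₁₃ r s := by
  simp only [kubertTateX₁₃, kubertTateRaw₁₃]
  ring

end Ring

/-! ### Multiples of the marked point in the coordinates `(r, s)` -/

section Field

variable {F : Type*} [Field F] [DecidableEq F]

omit [DecidableEq F] in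
/-- Transport of an affine point along equalities of its coordinates (the nonsingularity witness
is proof-irrelevant). [folklore] -/
private theorem some_eq_some_of_coord_eq {W : WeierstrassCurve F} {x y x' y' : F}
    (h : W.toAffine.Nonsingular x y) (hx : x = x') (hy : y = y') :
    ∃ h', (Affine.Point.some x y h : W.toAffine.Point) = Affine.Point.some x' y' h' := by
  subst hx hy
  exact ⟨h, rfl⟩

/-- **Chord step on the Tate normal form**: for a nonsingular affine point `(x₁, y₁)` of `E(b, c)`
with `x₁ ≠ 0`, the chord through `(x₁, y₁)` and `P = (0, 0)` has slope `λ = y₁/x₁` and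
`(x₁, y₁) + (0, 0) = (x₃, y₃)` with `x₃ = λ² + (1 - c)λ + b - x₁`, `y₃ = -(λ + 1 - c)x₃ + b`
(Mathlib's addition law with `a₁ = 1 - c`, `a₂ = a₃ = -b`, the line passing through the origin;
equivalently Sutherland's `x_{n+1} = b yₙ/xₙ²` after using the curve equation). [folklore] -/
theorem kubertTate_some_add_some_zero (b c : F) {x₁ y₁ : F}
    (h₁ : (kubertTate b c).toAffine.Nonsingular x₁ y₁)
    (h₀ : (kubertTate b c).toAffine.Nonsingular 0 0) (hx : x₁ ≠ 0) :
    ∃ h₃ : (kubertTate b c).toAffine.Nonsingular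
        ((y₁ / x₁) ^ 2 + (1 - c) * (y₁ / x₁) + b - x₁)
        (-((y₁ / x₁ + (1 - c)) * ((y₁ / x₁) ^ 2 + (1 - c) * (y₁ / x₁) + b - x₁)) + b),
      Affine.Point.some x₁ y₁ h₁ + Affine.Point.some 0 0 h₀ = Affine.Point.some _ _ h₃ := by
  have hL : (kubertTate b c).toAffine.slope x₁ 0 y₁ 0 = y₁ / x₁ := by
    rw [Affine.slope_of_X_ne hx, sub_zero, sub_zero]
  have hX : (kubertTate b c).toAffine.addX x₁ 0 ((kubertTate b c).toAffine.slope x₁ 0 y₁ 0) =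
      (y₁ / x₁) ^ 2 + (1 - c) * (y₁ / x₁) + b - x₁ := by
    rw [hL]
    simp only [Affine.addX, kubertTate]
    ring
  have hY : (kubertTate b c).toAffine.addY x₁ 0 y₁ ((kubertTate b c).toAffine.slope x₁ 0 y₁ 0) =
      -((y₁ / x₁ + (1 - c)) * ((y₁ / x₁) ^ 2 + (1 - c) * (y₁ / x₁) + b - x₁)) + b := by
    rw [Affine.addY, Affine.negAddY, hX, hL]
    simp only [Affine.negY, kubertTate]
    field_simp
    ring
  have hns := Affine.nonsingular_add h₁ h₀ fun hxy => hx hxy.1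
  rw [hX, hY] at hns
  refine ⟨hns, ?_⟩
  rw [Affine.Point.add_of_X_ne hx]
  congr 1

variable (r s : F)

/-- **`4P = (r(r - 1), r²(r - 1)(s - 1))`** on `E(rs(r-1), s(r-1))` (`4P = 3P + P` with
`3P = (c, b - c)`, chord slope `(b - c)/c = r - 1`). [cite: Sutherland2012, §2 (table of xₙ: x₄ = r(r−1))] -/
theorem kubertTate_four_nsmul_zero
    (h₀ : (kubertTate (r * s * (r - 1)) (s * (r - 1))).toAffine.Nonsingular 0 0)
    (hr₁ : r ≠ 1) (hs : s ≠ 0) :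
    ∃ h, 4 • (Affine.Point.some 0 0 h₀ : (kubertTate (r * s * (r - 1)) (s * (r - 1))).toAffine.Point)
      = Affine.Point.some (r * (r - 1)) (r ^ 2 * (r - 1) * (s - 1)) h := by
  have hx : s * (r - 1) ≠ 0 := mul_ne_zero hs (sub_ne_zero.mpr hr₁)
  rw [show (4 : ℕ) = 3 + 1 from rfl, succ_nsmul, kubertTate_three_nsmul_zero _ _ h₀]
  obtain ⟨h₄, e⟩ := kubertTate_some_add_some_zero (r * s * (r - 1)) (s * (r - 1))
    (kubertTate_nonsingular_three _ _ ((kubertTate_nonsingular_zero_iff _ _).mp h₀)) h₀ hx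
  rw [e]
  have hL : (r * s * (r - 1) - s * (r - 1)) / (s * (r - 1)) = r - 1 := by
    rw [div_eq_iff hx]
    ring
  apply some_eq_some_of_coord_eq h₄
  · rw [hL]
    ring
  · rw [hL]
    ring

/-- **`5P = (rs(s - 1), rs²(r - s))`** on `E(rs(r-1), s(r-1))` (`5P = 4P + P`, chord slope
`r(s - 1)`). [cite: Sutherland2012, §2 (table of xₙ: x₅ = rs(s−1))] -/
theorem kubertTate_five_nsmul_zero
    (h₀ : (kubertTate (r * s * (r - 1)) (s * (r - 1))).toAffine.Nonsingular 0 0)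
    (hr : r ≠ 0) (hr₁ : r ≠ 1) (hs : s ≠ 0) :
    ∃ h, 5 • (Affine.Point.some 0 0 h₀ : (kubertTate (r * s * (r - 1)) (s * (r - 1))).toAffine.Point)
      = Affine.Point.some (r * s * (s - 1)) (r * s ^ 2 * (r - s)) h := by
  obtain ⟨h₄, e₄⟩ := kubertTate_four_nsmul_zero r s h₀ hr₁ hs
  have hx : r * (r - 1) ≠ 0 := mul_ne_zero hr (sub_ne_zero.mpr hr₁)
  rw [show (5 : ℕ) = 4 + 1 from rfl, succ_nsmul, e₄]
  obtain ⟨h₅, e⟩ := kubertTate_some_add_some_zero (r * s * (r - 1)) (s * (r - 1)) h₄ h₀ hx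
  rw [e]
  have hL : r ^ 2 * (r - 1) * (s - 1) / (r * (r - 1)) = r * (s - 1) := by
    rw [div_eq_iff hx]
    ring
  apply some_eq_some_of_coord_eq h₅
  · rw [hL]
    ring
  · rw [hL]
    ring

/-- **`6P = (s(r - 1)(r - s)/(s - 1)², s²(r - 1)²(rs - 2r + 1)/(s - 1)³)`** on `E(rs(r-1), s(r-1))`,
for `s ≠ 1` (`6P = 5P + P`, chord slope `s(r - s)/(s - 1)`). [cite: Sutherland2012, §2 (table of xₙ: x₆ = s(r−1)(r−s)/(s−1)²)] -/
theorem kubertTate_six_nsmul_zero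
    (h₀ : (kubertTate (r * s * (r - 1)) (s * (r - 1))).toAffine.Nonsingular 0 0)
    (hr : r ≠ 0) (hr₁ : r ≠ 1) (hs : s ≠ 0) (hs₁ : s ≠ 1) :
    ∃ h, 6 • (Affine.Point.some 0 0 h₀ : (kubertTate (r * s * (r - 1)) (s * (r - 1))).toAffine.Point)
      = Affine.Point.some (s * (r - 1) * (r - s) / (s - 1) ^ 2)
          (s ^ 2 * (r - 1) ^ 2 * (r * s - 2 * r + 1) / (s - 1) ^ 3) h := by
  obtain ⟨h₅, e₅⟩ := kubertTate_five_nsmul_zero r s h₀ hr hr₁ hs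
  have hs₁' : s - 1 ≠ 0 := sub_ne_zero.mpr hs₁
  have hx : r * s * (s - 1) ≠ 0 := mul_ne_zero (mul_ne_zero hr hs) hs₁'
  rw [show (6 : ℕ) = 5 + 1 from rfl, succ_nsmul, e₅]
  obtain ⟨h₆, e⟩ := kubertTate_some_add_some_zero (r * s * (r - 1)) (s * (r - 1)) h₅ h₀ hx
  rw [e]
  have hL : r * s ^ 2 * (r - s) / (r * s * (s - 1)) = s * (r - s) / (s - 1) := by
    rw [div_eq_div_iff hx hs₁']
    ring
  apply some_eq_some_of_coord_eq h₆
  · rw [hL]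
    field_simp
    ring
  · rw [hL]
    field_simp
    ring

/-- **`x(7P) = x(6P) - s(r - 1)·F₁₃(r, s)/((s - 1)²(r - s)²)`** on `E(rs(r-1), s(r-1))`, for
`s ≠ 1`, `r ≠ s` (`7P = 6P + P`, chord slope `s(r-1)(rs-2r+1)/((s-1)(r-s))`; equivalently
`x(7P) = rs(r-1)(s-1)(rs-2r+1)/(r-s)²`). This identity is the whole content of the raw model:
`13P = 𝒪 ⟺ 7P = -6P ⟺ x(7P) = x(6P)`. [cite: Sutherland2012, §2 (x₇ = x₆ for N = 13; table of xₙ)] -/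
theorem kubertTate_seven_nsmul_zero
    (h₀ : (kubertTate (r * s * (r - 1)) (s * (r - 1))).toAffine.Nonsingular 0 0)
    (hr : r ≠ 0) (hr₁ : r ≠ 1) (hs : s ≠ 0) (hs₁ : s ≠ 1) (hrs : r ≠ s) :
    ∃ y h, 7 • (Affine.Point.some 0 0 h₀ : (kubertTate (r * s * (r - 1)) (s * (r - 1))).toAffine.Point)
      = Affine.Point.some (s * (r - 1) * (r - s) / (s - 1) ^ 2
          - s * (r - 1) * kubertTateRaw₁₃ r s / ((s - 1) ^ 2 * (r - s) ^ 2)) y h := by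
  obtain ⟨h₆, e₆⟩ := kubertTate_six_nsmul_zero r s h₀ hr hr₁ hs hs₁
  have hs₁' : s - 1 ≠ 0 := sub_ne_zero.mpr hs₁
  have hr₁' : r - 1 ≠ 0 := sub_ne_zero.mpr hr₁
  have hrs' : r - s ≠ 0 := sub_ne_zero.mpr hrs
  have hx : s * (r - 1) * (r - s) / (s - 1) ^ 2 ≠ 0 :=
    div_ne_zero (mul_ne_zero (mul_ne_zero hs hr₁') hrs') (pow_ne_zero 2 hs₁')
  rw [show (7 : ℕ) = 6 + 1 from rfl, succ_nsmul, e₆]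
  obtain ⟨h₇, e⟩ := kubertTate_some_add_some_zero (r * s * (r - 1)) (s * (r - 1)) h₆ h₀ hx
  rw [e]
  have hL : s ^ 2 * (r - 1) ^ 2 * (r * s - 2 * r + 1) / (s - 1) ^ 3
      / (s * (r - 1) * (r - s) / (s - 1) ^ 2)
      = s * (r - 1) * (r * s - 2 * r + 1) / ((s - 1) * (r - s)) := by
    rw [div_eq_iff hx]
    field_simp
  have key : ∀ {x y : F} (t : F)
      (h : (kubertTate (r * s * (r - 1)) (s * (r - 1))).toAffine.Nonsingular x y), x = t →
      ∃ y' h', (Affine.Point.some x y h : (kubertTate (r * s * (r - 1)) (s * (r - 1))).toAffine.Point)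
        = Affine.Point.some t y' h' :=
    fun t h hx => ⟨_, some_eq_some_of_coord_eq h hx rfl⟩
  refine key _ h₇ ?_
  rw [hL]
  simp only [kubertTateRaw₁₃]
  field_simp
  ring

/-- **The raw model of `X₁(13)`, `(r, s)` chart**: on `E(rs(r-1), s(r-1))` with `r ∉ {0, 1}`,
`s ∉ {0, 1}`, `r ≠ s` (the open part of the `(r, s)`-plane where `b ≠ 0` and `6P, 7P` are affine
with the displayed coordinates), `13 · (0,0) = 𝒪 ⟺ F₁₃(r, s) = 0`. Proof: `13P = 7P + 6P = 𝒪`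
iff `7P = -6P` iff `x(7P) = x(6P)` (the alternative `7P = 6P` would give `P = 𝒪`), iff the
correction term `s(r-1)F₁₃/((s-1)²(r-s)²)` of `kubertTate_seven_nsmul_zero` vanishes. [cite: Sutherland2012, §2 ("NP = 0_E ⟺ x_m = x_n", N = 13, m = 7, n = 6)] -/
theorem kubertTate_thirteen_nsmul_zero_iff
    (h₀ : (kubertTate (r * s * (r - 1)) (s * (r - 1))).toAffine.Nonsingular 0 0)
    (hr : r ≠ 0) (hr₁ : r ≠ 1) (hs : s ≠ 0) (hs₁ : s ≠ 1) (hrs : r ≠ s) :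
    13 • (Affine.Point.some 0 0 h₀ : (kubertTate (r * s * (r - 1)) (s * (r - 1))).toAffine.Point)
      = 0 ↔ kubertTateRaw₁₃ r s = 0 := by
  obtain ⟨h₆, e₆⟩ := kubertTate_six_nsmul_zero r s h₀ hr hr₁ hs hs₁
  obtain ⟨y₇, h₇, e₇⟩ := kubertTate_seven_nsmul_zero r s h₀ hr hr₁ hs hs₁ hrs
  have hs₁' : s - 1 ≠ 0 := sub_ne_zero.mpr hs₁
  have hr₁' : r - 1 ≠ 0 := sub_ne_zero.mpr hr₁
  have hrs' : r - s ≠ 0 := sub_ne_zero.mpr hrs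
  have e13 : 13 • (Affine.Point.some 0 0 h₀ :
      (kubertTate (r * s * (r - 1)) (s * (r - 1))).toAffine.Point)
      = 7 • Affine.Point.some 0 0 h₀ + 6 • Affine.Point.some 0 0 h₀ := by
    rw [show (13 : ℕ) = 7 + 6 from rfl, add_nsmul]
  constructor
  · intro h
    rw [e13] at h
    have h' := eq_neg_of_add_eq_zero_left h
    rw [e₆, e₇, Affine.Point.neg_some, Affine.Point.some.injEq] at h'
    have hx : s * (r - 1) * kubertTateRaw₁₃ r s / ((s - 1) ^ 2 * (r - s) ^ 2) = 0 := by
      linear_combination -h'.1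
    rcases div_eq_zero_iff.mp hx with h0 | h0
    · rcases mul_eq_zero.mp h0 with h1 | h1
      · exact absurd h1 (mul_ne_zero hs hr₁')
      · exact h1
    · exact absurd h0 (mul_ne_zero (pow_ne_zero 2 hs₁') (pow_ne_zero 2 hrs'))
  · intro hF
    obtain ⟨h₇', e₇'⟩ := some_eq_some_of_coord_eq h₇
      (x' := s * (r - 1) * (r - s) / (s - 1) ^ 2) (y' := y₇)
      (by rw [hF, mul_zero, zero_div, sub_zero]) rfl
    rw [e₇'] at e₇
    rcases (Affine.Point.X_eq_iff (h₁ := h₇') (h₂ := h₆)).mp rfl with h | h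
    · exfalso
      rw [← e₇, ← e₆, succ_nsmul, add_eq_left] at h
      exact Affine.Point.some_ne_zero h₀ h
    · rw [e13, e₇, e₆, h, neg_add_cancel]

omit [DecidableEq F] in
/-- In an additive group, `(k+1)·P = ±P` forces `k·P = 0` or `(k+2)·P = 0`. [folklore] -/
private theorem nsmul_eq_zero_or_of_eq_or_eq_neg {A : Type*} [AddGroup A] (P : A) (k : ℕ)
    (h : (k + 1) • P = P ∨ (k + 1) • P = -P) : k • P = 0 ∨ (k + 2) • P = 0 := by
  rcases h with h | h
  · left
    rwa [succ_nsmul, add_eq_right] at h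
  · right
    rw [succ_nsmul] at h
    rw [show k + 2 = k + 1 + 1 from rfl, succ_nsmul, succ_nsmul, h, neg_add_cancel]

/-! ### The raw model of `X₁(13)` in the coordinates `(b, c)` -/

variable (b c : F)

omit [DecidableEq F] in
/-- **Passage to Sutherland's coordinates**: if `c ≠ 0` and `b ≠ c` then `b = rs(r - 1)`,
`c = s(r - 1)` for `r = b/c`, `s = c²/(b - c)`. [cite: Sutherland2012, §2 (r = b/c, s = c²/(b−c))] -/
theorem exists_kubertTate_param (hc : c ≠ 0) (hbc : b - c ≠ 0) :
    ∃ r s : F, b = r * s * (r - 1) ∧ c = s * (r - 1) :=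
  ⟨b / c, c ^ 2 / (b - c), by field_simp, by field_simp⟩

/-- **The raw plane model of `X₁(13)` (Reichert, Sutherland), proved**: over any field, for
`b c` with `(0, 0)` a nonsingular point of the Tate normal form `E(b, c)` (i.e. `b ≠ 0`; `Δ(b, c)`
may vanish, in which case the group is that of the nonsingular points), the point `(0, 0)` has
order exactly `13` if and only if `X₁₃(b, c) = 0`. (`⟹`: order `13` makes `2P, …, 7P` nonzero and
`≠ ±P`, which by equality of `x`-coordinates (`X_eq_iff`) gives in turn `c ≠ 0` (`x(3P) ≠ x(P)`),
`b ≠ c` (`x(3P) ≠ x(2P)`), then in the `(r, s)` chart `s ≠ 1` (`x(5P) ≠ 0`), `r ≠ s`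
(`x(6P) ≠ 0`), and `kubertTate_thirteen_nsmul_zero_iff` gives `F₁₃(r, s) = 0`, whence
`X₁₃ = s⁷(r-1)¹¹F₁₃ = 0`. `⟸`: `X₁₃(b, 0) = b⁷` and `X₁₃(b, b) = -b¹¹` force `c ≠ 0`, `b ≠ c`;
in the `(r, s)` chart `F₁₃(r, s) = 0`, and `F₁₃(r, 1) = (r-1)³`, `F₁₃(s, s) = -s(s-1)⁵` force
`s ≠ 1`, `r ≠ s`; so `13P = 𝒪` with `P ≠ 𝒪`, i.e. `P` has order `13`.) This is Sutherland's
"`F(r, s) = 0` is a defining equation for `X₁(N)` … valid for any field `K`" for `N = 13`, in the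
`(b, c)`-plane. [cite: Sutherland2012, §2 (defining equation of X₁(N) in E(b,c)-coordinates, both directions, any field), N = 13] -/
theorem kubertTate_addOrderOf_zero_eq_thirteen_iff
    (h₀ : (kubertTate b c).toAffine.Nonsingular 0 0) :
    addOrderOf (Affine.Point.some 0 0 h₀ : (kubertTate b c).toAffine.Point) = 13 ↔
      kubertTateX₁₃ b c = 0 := by
  have hb : b ≠ 0 := (kubertTate_nonsingular_zero_iff b c).mp h₀
  set P₀ : (kubertTate b c).toAffine.Point := Affine.Point.some 0 0 h₀ with hP₀
  have e2 := kubertTate_two_nsmul_zero b c h₀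
  have e3 := kubertTate_three_nsmul_zero b c h₀
  constructor
  · intro h13
    have hdvd : ∀ k : ℕ, k • P₀ = 0 → 13 ∣ k := fun k hk =>
      h13 ▸ addOrderOf_dvd_of_nsmul_eq_zero hk
    -- `c ≠ 0`, else `x(3P) = x(P)`
    have hc : c ≠ 0 := by
      intro hc
      rcases nsmul_eq_zero_or_of_eq_or_eq_neg P₀ 2
        (by rw [hP₀, e3]; exact (Affine.Point.X_eq_iff (h₂ := h₀)).mp hc) with h | h
      · exact absurd (hdvd 2 h) (by norm_num)
      · exact absurd (hdvd 4 h) (by norm_num)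
    -- `b ≠ c`, else `x(3P) = x(2P)`
    have hbc : b - c ≠ 0 := by
      intro hbc
      rcases (Affine.Point.X_eq_iff
        (h₁ := kubertTate_nonsingular_three b c hb)
        (h₂ := kubertTate_nonsingular_two b c hb)).mp (sub_eq_zero.mp hbc).symm with h | h
      · rw [← e2, ← e3, succ_nsmul, add_eq_left] at h
        exact Affine.Point.some_ne_zero h₀ h
      · have h5 : 5 • P₀ = 0 := by
          rw [show (5 : ℕ) = 3 + 2 from rfl, add_nsmul, hP₀, e3, e2, h, neg_add_cancel]
        exact absurd (hdvd 5 h5) (by norm_num)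
    -- pass to `(r, s)`
    obtain ⟨r, s, rfl, rfl⟩ := exists_kubertTate_param b c hc hbc
    have hs : s ≠ 0 := left_ne_zero_of_mul hc
    have hr₁' : r - 1 ≠ 0 := right_ne_zero_of_mul hc
    have hr₁ : r ≠ 1 := sub_ne_zero.mp hr₁'
    have hr : r ≠ 0 := by
      intro h
      apply hb
      rw [h]
      ring
    -- `s ≠ 1`, else `x(5P) = 0 = x(P)`
    obtain ⟨h₅, e₅⟩ := kubertTate_five_nsmul_zero r s h₀ hr hr₁ hs
    have hs₁ : s ≠ 1 := by
      intro h1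
      rcases nsmul_eq_zero_or_of_eq_or_eq_neg P₀ 4
        (by rw [hP₀, e₅]; exact (Affine.Point.X_eq_iff (h₂ := h₀)).mp (by rw [h1]; ring))
        with h | h
      · exact absurd (hdvd 4 h) (by norm_num)
      · exact absurd (hdvd 6 h) (by norm_num)
    -- `r ≠ s`, else `x(6P) = 0 = x(P)`
    obtain ⟨h₆, e₆⟩ := kubertTate_six_nsmul_zero r s h₀ hr hr₁ hs hs₁
    have hrs : r ≠ s := by
      intro h1
      rcases nsmul_eq_zero_or_of_eq_or_eq_neg P₀ 5
        (by rw [hP₀, e₆]; exact (Affine.Point.X_eq_iff (h₂ := h₀)).mp (by rw [h1]; ring))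
        with h | h
      · exact absurd (hdvd 5 h) (by norm_num)
      · exact absurd (hdvd 7 h) (by norm_num)
    have h13' : 13 • P₀ = 0 := addOrderOf_dvd_iff_nsmul_eq_zero.mp (h13 ▸ dvd_refl _)
    rw [kubertTateX₁₃_eq_mul_raw,
      (kubertTate_thirteen_nsmul_zero_iff r s h₀ hr hr₁ hs hs₁ hrs).mp h13', mul_zero]
  · intro hX
    have hc : c ≠ 0 := by
      intro hc
      rw [hc, kubertTateX₁₃_zero_right] at hX
      exact hb (pow_eq_zero_iff (n := 7) (by norm_num) |>.mp hX)
    have hbc : b - c ≠ 0 := by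
      intro hbc
      rw [(sub_eq_zero.mp hbc).symm, kubertTateX₁₃_self_self, neg_eq_zero] at hX
      exact hb (pow_eq_zero_iff (n := 11) (by norm_num) |>.mp hX)
    obtain ⟨r, s, rfl, rfl⟩ := exists_kubertTate_param b c hc hbc
    have hs : s ≠ 0 := left_ne_zero_of_mul hc
    have hr₁' : r - 1 ≠ 0 := right_ne_zero_of_mul hc
    have hr₁ : r ≠ 1 := sub_ne_zero.mp hr₁'
    have hr : r ≠ 0 := by
      intro h
      apply hb
      rw [h]
      ring
    rw [kubertTateX₁₃_eq_mul_raw] at hX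
    have hF : kubertTateRaw₁₃ r s = 0 := by
      rcases mul_eq_zero.mp hX with h | h
      · exact absurd h (mul_ne_zero (pow_ne_zero 7 hs) (pow_ne_zero 11 hr₁'))
      · exact h
    have hs₁ : s ≠ 1 := by
      intro h1
      rw [h1, kubertTateRaw₁₃_self_one] at hF
      exact hr₁' (pow_eq_zero_iff (n := 3) (by norm_num) |>.mp hF)
    have hrs : r ≠ s := by
      intro h1
      rw [h1, kubertTateRaw₁₃_self_self, neg_eq_zero] at hF
      rcases mul_eq_zero.mp hF with h | h
      · exact hs h
      · exact hs₁ (sub_eq_zero.mp (pow_eq_zero_iff (n := 5) (by norm_num) |>.mp h))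
    haveI : Fact (Nat.Prime 13) := ⟨by decide⟩
    exact addOrderOf_eq_prime
      ((kubertTate_thirteen_nsmul_zero_iff r s h₀ hr hr₁ hs hs₁ hrs).mpr hF)
      (Affine.Point.some_ne_zero h₀)

/-- **The raw plane model of `X₁(13)`, `(r, s)` chart, exact-order form**: on `E(rs(r-1), s(r-1))`
with `(0, 0)` nonsingular (i.e. `r ∉ {0, 1}`, `s ≠ 0`), `(0, 0)` has order `13` iff
`F₁₃(r, s) = 0` (from the `(b, c)` form and `X₁₃ = s⁷(r-1)¹¹F₁₃`). [cite: Sutherland2012, §2 (F(r,s) = 0 defining equation of X₁(N)), N = 13] -/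
theorem kubertTate_addOrderOf_zero_eq_thirteen_iff_raw
    (h₀ : (kubertTate (r * s * (r - 1)) (s * (r - 1))).toAffine.Nonsingular 0 0) :
    addOrderOf (Affine.Point.some 0 0 h₀ : (kubertTate (r * s * (r - 1)) (s * (r - 1))).toAffine.Point)
      = 13 ↔ kubertTateRaw₁₃ r s = 0 := by
  have hb : r * s * (r - 1) ≠ 0 := (kubertTate_nonsingular_zero_iff _ _).mp h₀
  have hs : s ≠ 0 := right_ne_zero_of_mul (left_ne_zero_of_mul hb)
  have hr₁' : r - 1 ≠ 0 := right_ne_zero_of_mul hb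
  rw [kubertTate_addOrderOf_zero_eq_thirteen_iff, kubertTateX₁₃_eq_mul_raw, mul_eq_zero,
    or_iff_right (mul_ne_zero (pow_ne_zero 7 hs) (pow_ne_zero 11 hr₁'))]

end Field

end WeierstrassCurve

end
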